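import Literature.Geometry.Riemannian.VolumeSphereTheoremJacobiFrameProofs
import HarnessLib

/-!
# The normal Jacobi tensor in a parallel orthonormal frame — explicit variation fields

`Literature.Geometry.Riemannian.normalJacobiTensor_frame`
(`Literature/Geometry/Riemannian/VolumeSphereTheoremJacobiFrameProofs.lean`, §F15) assembles,
along the geodesic `γ_v = maximalGeodesic g.leviCivita p v` of a complete Levi-Civita connection
and for a full frame `f(t) : Option ι → T_{γ_v(t)}M` (`f(t) none = γ̇_v(t)`, normal part parallel
on `(a, b) ∋ 0`, orthonormal on `(a, b)`, `card (Option ι) = dim M`), the matrix Jacobi system of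
Chavel 2006, §III.4 (proof of Thm. III.4.3): for the normal Jacobi tensor matrices
`A = (g(J_k, eᵢ))`, `A₁ = (g(D_t J_k, eᵢ))`, `R = (g(R(eⱼ, γ̇)γ̇, eᵢ))` one has `A' = A₁`,
`A₁' = -R A`, `Rᵀ = R`, `tr R = Ric(γ̇, γ̇)`, `A(0) = 0`, `A₁(0) = 1` and `det A(t) ≠ 0` wherever
`d(exp_p)_{tv}` is injective — but with the Jacobi fields hidden behind an existential `∃ J`.

This file records the SAME statement with the Jacobi fields written out: `J_k` is the variation
field `J_k(t) = ∂_s|₀ γ_{v + s w_k}(t)` of the geodesic variation through `exp_p`, with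
`w_k = e_k(0)` read in `T_pM` (these are the fields `d(exp_p)_{tv}(t w_k)`, by
`velocity_geodesicVariation_eq_mfderiv_expMap` of `JacobiVariation.lean`), together with one more
conjunct, the normality `g(J_k(t), γ̇_v(t)) = 0` for all `k` and all `t`
(`val_velocity_eq_zero_of_isJacobiFieldAlongOn`: Jacobi fields with normal initial data stay
normal). The proof is that of `normalJacobiTensor_frame`, whose existential witness is exactly
this `J`.

## References

* I. Chavel, *Riemannian geometry: a modern introduction*, 2nd ed., CUP 2006, §III.4,
  Thm. III.4.3 (proof). [Chavel2006]
* J. Cheeger, T. H. Colding, J. Differential Geom. 46 (1997) 406–480, (0.5). [CheegerColding1997]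
-/

noncomputable section

open Bundle Set Filter Function
open scoped Manifold ContDiff Topology

namespace Literature.Geometry.Riemannian

open Literature.Geometry.Lorentzian

variable {E : Type*} [NormedAddCommGroup E] [NormedSpace ℝ E] [FiniteDimensional ℝ E]
  {H : Type*} [TopologicalSpace H] {I : ModelWithCorners ℝ E H}
  {M : Type*} [TopologicalSpace M] [ChartedSpace H M] [IsManifold I ∞ M] {n : ℕ∞ω}
  [CompleteSpace E] [T2Space M] [I.Boundaryless] [Fact (1 ≤ n)]
  (g : PseudoRiemannianMetric I n E (TangentSpace I : M → Type _)) [g.HasLeviCivita]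
  [CovariantDerivative.ContMDiffCovariantDerivative g.leviCivita 1]
  [CovariantDerivative.ContMDiffCovariantDerivative g.leviCivita ∞]

/-- **The normal Jacobi tensor in a parallel orthonormal frame, explicit variation fields**
(Chavel 2006, §III.4, set-up and proof of Thm. III.4.3). Along the geodesic `γ_v` of a complete
Levi-Civita connection (locally `C¹`, `n ≥ 2`), let `f(t) : Option ι → T_{γ_v(t)}M` be a full
frame with `f(t)(none) = γ̇_v(t)`, whose normal part `eᵢ(t) = f(t)(some i)` is parallel on an open
parameter interval `(a, b) ∋ 0`, and which is `g`-orthonormal on `(a, b)` with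
`card (Option ι) = dim M`. Put `w_k = e_k(0) ∈ T_pM` and let
`J_k(t) = ∂_s|₀ (maximalGeodesic p (v + s w_k) t)` be the variation fields (the Jacobi fields
with `J_k(0) = 0`, `D_t J_k(0) = e_k(0)`), `A = (g(J_k, eᵢ))`, `A₁ = (g(D_t J_k, eᵢ))`,
`R = (g(R(eⱼ, γ̇)γ̇, eᵢ))` (`ι × ι` matrices). Then on `(a, b)`: `A' = A₁`, `A₁' = -R A`,
`Rᵀ = R`, `tr R = Ric(γ̇, γ̇)`; `A(0) = 0`, `A₁(0) = 1`; `det A(t) ≠ 0` wherever `d(exp_p)_{tv}`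
is injective (`t ≠ 0`); and every `J_k` is normal to `γ̇_v` at every parameter.
[cite: Chavel2006, §III.4, Thm. III.4.3 (proof)] -/
theorem normalJacobiTensor_frame_explicit (hreg : g.leviCivita.IsLocallyContMDiff 1) (hn : 2 ≤ n)
    (hc : IsGeodesicallyComplete g.leviCivita) (p : M) (v : TangentSpace I p)
    {ι : Type*} [Fintype ι] [DecidableEq ι] {a b : ℝ} (h0 : (0 : ℝ) ∈ Ioo a b)
    (f : Π t : ℝ, Option ι → TangentSpace I (maximalGeodesic g.leviCivita p v t))
    (hfnone : ∀ t, f t none = velocity I (maximalGeodesic g.leviCivita p v) t)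
    (hfpar : ∀ i, IsParallelAlongOn g.leviCivita (maximalGeodesic g.leviCivita p v)
      (fun t ↦ f t (some i)) (Ioo a b))
    (hon : ∀ t ∈ Ioo a b, ∀ o o', g.val (maximalGeodesic g.leviCivita p v t) (f t o) (f t o') =
      if o = o' then 1 else 0)
    (hcard : Fintype.card (Option ι) = Module.finrank ℝ E) :
    let w : ι → TangentSpace I p := fun k ↦ (show E from f 0 (some k))
    let J : ι → Π t : ℝ, TangentSpace I (maximalGeodesic g.leviCivita p v t) := fun k t ↦
      velocity I (fun s' : ℝ ↦ maximalGeodesic g.leviCivita p (v + s' • w k) t) 0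
    let A : ℝ → Matrix ι ι ℝ := fun t ↦ Matrix.of fun i k ↦
      g.val (maximalGeodesic g.leviCivita p v t) (J k t) (f t (some i))
    let A₁ : ℝ → Matrix ι ι ℝ := fun t ↦ Matrix.of fun i k ↦
      g.val (maximalGeodesic g.leviCivita p v t)
        (covariantDerivAlong g.leviCivita (maximalGeodesic g.leviCivita p v) (J k) t) (f t (some i))
    let R : ℝ → Matrix ι ι ℝ := fun t ↦ Matrix.of fun i j ↦
      g.val (maximalGeodesic g.leviCivita p v t) (g.leviCivita.curvature
        (maximalGeodesic g.leviCivita p v t) (f t (some j))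
        (velocity I (maximalGeodesic g.leviCivita p v) t)
        (velocity I (maximalGeodesic g.leviCivita p v) t)) (f t (some i))
    (∀ t ∈ Ioo a b, HasDerivAt A (A₁ t) t) ∧
    (∀ t ∈ Ioo a b, HasDerivAt A₁ (-(R t * A t)) t) ∧
    (∀ t ∈ Ioo a b, (R t).IsSymm) ∧
    (∀ t ∈ Ioo a b, (R t).trace = g.leviCivita.ricci (maximalGeodesic g.leviCivita p v t)
      (velocity I (maximalGeodesic g.leviCivita p v) t)
      (velocity I (maximalGeodesic g.leviCivita p v) t)) ∧
    A 0 = 0 ∧ A₁ 0 = 1 ∧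
    (∀ t ∈ Ioo a b, t ≠ 0 → Injective (mfderiv 𝓘(ℝ, E) I
      (fun u : E ↦ expMap g.leviCivita p (show TangentSpace I p from u)) (t • (show E from v))) →
      (A t).det ≠ 0) ∧
    (∀ k t, g.val (maximalGeodesic g.leviCivita p v t) (J k t)
      (velocity I (maximalGeodesic g.leviCivita p v) t) = 0) := by
  intro w J A A₁ R
  have hLC := PseudoRiemannianMetric.isLeviCivita_leviCivita_holds (g := g)
  obtain ⟨-, hgeo, -, -⟩ := maximalGeodesic_of_isGeodesicallyComplete hc p v
  -- the variation fields `J_k` are the Jacobi fields with `J_k(0) = 0`, `D_t J_k(0) = w_k`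
  have hvw : ∀ k, v + (0 : ℝ) • w k = v := fun k ↦ by rw [zero_smul, add_zero]
  have hJprop : ∀ k, IsJacobiFieldAlongOn g (maximalGeodesic g.leviCivita p v) (J k) univ ∧
      J k 0 = 0 ∧
      covariantDerivAlong g.leviCivita (maximalGeodesic g.leviCivita p v) (J k) 0 = w k ∧
      (∀ t, MDifferentiableAt 𝓘(ℝ, ℝ) I.tangent (fun t ↦ (TotalSpace.mk' E
        (maximalGeodesic g.leviCivita p v t) (J k t) : TangentBundle I M)) t) ∧
      ∀ t, MDifferentiableAt 𝓘(ℝ, ℝ) I.tangent (fun t ↦ (TotalSpace.mk' E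
        (maximalGeodesic g.leviCivita p v t)
        (covariantDerivAlong g.leviCivita (maximalGeodesic g.leviCivita p v) (J k) t) :
          TangentBundle I M)) t := by
    intro k
    have h := jacobiField_geodesicVariation g hreg hc p v (w k)
    rw [hvw k] at h
    exact h
  -- normality of the `J_k` and their expansion in the normal frame
  have hnormal : ∀ k t, g.val _ (J k t) (velocity I (maximalGeodesic g.leviCivita p v) t) = 0 ∧
      g.val _ (covariantDerivAlong g.leviCivita (maximalGeodesic g.leviCivita p v) (J k) t)
        (velocity I (maximalGeodesic g.leviCivita p v) t) = 0 := by
    intro k t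
    refine val_velocity_eq_zero_of_isJacobiFieldAlongOn g hreg hn hgeo (hJprop k).1
      (hJprop k).2.2.2.1 (hJprop k).2.2.2.2 ?_ ?_ t
    · rw [(hJprop k).2.1, map_zero, zero_apply]
    · rw [(hJprop k).2.2.1, ← hfnone 0]
      have h := hon 0 h0 (some k) none
      simpa using h
  have hexpand : ∀ t ∈ Ioo a b, ∀ u : TangentSpace I (maximalGeodesic g.leviCivita p v t),
      g.val _ u (velocity I (maximalGeodesic g.leviCivita p v) t) = 0 →
        u = ∑ i, g.val _ u (f t (some i)) • f t (some i) := by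
    intro t ht u hu
    refine eq_sum_normal_of_val_eq_zero g (maximalGeodesic g.leviCivita p v t) (hon t ht) hcard ?_
    rw [hfnone t]; exact hu
  refine ⟨?_, ?_, ?_, ?_, ?_, ?_, ?_, fun k t ↦ (hnormal k t).1⟩
  · -- `A' = A₁`
    intro t ht
    refine hasDerivAt_pi.2 fun i ↦ hasDerivAt_pi.2 fun k ↦ ?_
    simp only [A, A₁, Matrix.of_apply]
    exact hasDerivAt_val_apply_of_isParallelAlongOn g hLC.2 ((hJprop k).2.2.2.1 t) (hfpar i) ht
  · -- `A₁' = -R A`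
    intro t ht
    refine hasDerivAt_pi.2 fun i ↦ hasDerivAt_pi.2 fun k ↦ ?_
    simp only [A, A₁, R, Matrix.of_apply, Matrix.neg_apply, Matrix.mul_apply]
    exact hasDerivAt_val_covariantDerivAlong_frame_of_expansion g
      (fun s hs ↦ (hJprop k).1 s (mem_univ s)) ((hJprop k).2.2.2.2 t) hfpar ht
      (hexpand t ht (J k t) (hnormal k t).1) i
  · -- `Rᵀ = R`
    intro t ht
    exact isSymm_frameMatrix_curvature g hLC.2 hreg hLC.1 hn (fun i t ↦ f t (some i)) t
  · -- `tr R = Ric(γ̇, γ̇)`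
    intro t ht
    simp only [R, Matrix.trace, Matrix.diag_apply, Matrix.of_apply]
    have h := sum_val_curvature_normal_eq_ricci g g.leviCivita (maximalGeodesic g.leviCivita p v t)
      (hon t ht) hcard
    rw [hfnone t] at h
    exact h
  · -- `A(0) = 0`
    ext i k
    simp only [A, Matrix.of_apply, Matrix.zero_apply, (hJprop k).2.1, map_zero, zero_apply]
  · -- `A₁(0) = 1`
    ext i k
    simp only [A₁, Matrix.of_apply, Matrix.one_apply, (hJprop k).2.2.1]
    have h := hon 0 h0 (some k) (some i)
    simp only [Option.some.injEq] at h
    rw [show g.val (maximalGeodesic g.leviCivita p v 0) (w k) (f 0 (some i)) =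
      g.val (maximalGeodesic g.leviCivita p v 0) (f 0 (some k)) (f 0 (some i)) from rfl, h]
    by_cases hik : i = k
    · subst hik; simp
    · simp [hik, Ne.symm hik]
  · -- `det A(t) ≠ 0` where `d(exp_p)_{tv}` is injective
    intro t ht ht0 hinj
    have hw0 : LinearIndependent ℝ fun k ↦ (show E from w k) := by
      have hon0 : ∀ i j, g.val (maximalGeodesic g.leviCivita p v 0) (f 0 (some i)) (f 0 (some j)) =
          if i = j then 1 else 0 := fun i j ↦ by
        have h := hon 0 h0 (some i) (some j)
        simp only [Option.some.injEq] at h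
        exact h
      exact linearIndependent_of_bilin_orthonormal (V := E)
        (g.val (maximalGeodesic g.leviCivita p v 0)) hon0
    exact det_frameMatrix_ne_zero_of_mfderiv_expMap_injective_normal g hc p v w hw0
      (fun i t ↦ f t (some i)) ht0 (fun k ↦ (hnormal k t).1) (hexpand t ht) hinj

end Literature.Geometry.Riemannian

end
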